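import Literature.NumberTheory.EllipticCurves.Sprung2024.ChromaticSmallControlSurjProofs
import Literature.NumberTheory.EllipticCurves.IwasawaTowerTorsionFiniteProofs
import Literature.NumberTheory.EllipticCurves.AnomalousOfRationalTorsionProofs
import HarnessLib

/-!
# Sprung 2024, §5.2 Lemmas 5.8 · 5.9 PROVED for the chromatic Selmer groups: the ♯/♭ `Γ`-Euler
# characteristic in rank `0` reduced to Lemma 5.5 alone (the ♯/♭ twin of
# `IwasawaEulerCharRankZeroAssemblyProofs`)

`Proofs` file (theorems only: **no definition, no named fact**; axioms standard) in the cluster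
`Sprung2024`, next to `ChromaticCharValueRankZero[AllN].lean`, whose named facts
`lem59[AllN]_sharpFlatCharValue_rankZero` vendor F. Sprung, *On Iwasawa main conjectures for elliptic
curves at supersingular primes: beyond the case `a_p = 0`*, Adv. Math. **449** (2024) 109741
[Sprung2024], §5.2 **Lemmas 5.5 · 5.8 · 5.9 multiplied** (pp. 40–41; = arXiv:1610.10017 §4 Lemmas
4.5 · 4.4 · 4.8, pp. 15–16): "`f⋆(0) ∼ #Sel_{p^∞}(E/ℚ) · ∏_l c_l^{(p)}`" for a generator `f⋆` of
`char(X⋆)`, `X⋆ = Hom(Sel⋆(E/ℚ_∞), ℚ_p/ℤ_p)`. The three printed lemmas (arXiv numbering in brackets):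

* **Lemma 5.8 [4.4]** "`|Sel⋆(E,ℚ_∞)_p^Γ| = |Sel(E,ℚ)_p| / #E(ℚ)_p × |ker g|`" — "The proof of
  [Greenberg, LNM 1716, Lemma 4.3] with `Sel` replaced by `Sel⋆` works";
* **Lemma 5.9 [4.8]** "`|f(0)|_p = |Sel⋆(E,ℚ_∞)^Γ| / |(Sel⋆(E,ℚ_∞))_Γ|`" — "a general fact about
  finitely generated `Λ`-modules [Greenberg, Lemma 4.2]";
* **Lemma 5.5 [4.5]** "`1/|(Sel⋆(E,ℚ_∞)_p)_Γ| = (∏_{l bad} c_l^{(p)} / #E(ℚ)_p) × 1/|ker g|`" —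
  Greenberg's Lemma 4.7 (Cassels–Poitou–Tate, the surjectivity Lemma 4.6 over `ℚ_∞`) and the local
  Lemmas 3.3 / 4.4 (`|ker r_l| = c_l^{(p)}`), plus the `v = p` clause "`r_p` is injective".

Here `g : 𝒢⋆(ℚ) → 𝒢⋆(ℚ_∞)^Γ` is the right vertical map of the control diagram (p. 40), so — exactly
as the tree renders Greenberg's `ker g_n` (`WeierstrassCurve.KerG`, file
`IwasawaSelmerControlExactCountProofs`: "`ker g_n` IS `A_n / Sel_n`") — **`ker g = A⋆_0 / Sel_0`**
with `A⋆_0 = h_0⁻¹(Sel⋆(E/K_∞)) ⊆ H¹(K, E[p^∞])` (`(sharpFlatSelmerInfty …).comap (layerToInfty κ 0)`,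
the group of g5's `ChromaticSmallControlProofs` §2) and `Sel_0 = Sel_{p^∞}(E/K_0)` (`selmerLayer κ 0`;
`E⋆_{0,p} = E(ℚ_p) ⊗ ℚ_p/ℤ_p`, p. 39, so `Sel⋆(E/ℚ) = Sel(E/ℚ)`).

THIS FILE PROVES Lemmas 5.8 and 5.9 in the kernel for EVERY number field `K`, `ℤ_p`-extension `κ`
with topological generator `γ`, embedding `ι`, data `(ap, g, c, ⋆)` and Pontryagin-dual datum
`D : Sprung2012.SharpFlatSelmerDualData …` (`X⋆ = D.X`, `T = γ − 1`), and multiplies them: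

* §1 (**Lemma 5.8, unconditional `Nat.card` form**): `#A⋆_0 = #Sel⋆_∞^{Γ_K} · #ker h_0` (the
  restriction `A⋆_0 → Sel⋆_∞ ⊓ H¹(K_∞)^{Γ_K}` is onto by Greenberg's Lemma 3.2 = tree
  `ZpExtension.mem_range_resOfLe_of_conjH1_eq`, with kernel `ker h_0 ⊆ A⋆_0`), hence, when
  `h_0(Sel_0) ⊆ Sel⋆_∞` (g5's `layerToInfty_mem_sharpFlatSelmerInfty_of_mem_selmerLayer_zero`; a
  hypothesis `hSel` in general), **`#Sel⋆_∞^{Γ_K} · #ker h_0 = #Sel_0 · #(A⋆_0/Sel_0)`**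
  (`natCard_sharpFlatSelmerInvariants_mul_natCard_ker_layerToInfty`); the bridges
  `#Sel⋆_∞^{Γ_K} = #Sel⋆_∞^γ` (`natCard_sharpFlatSelmerInfty_inf_layerInvariants_zero_eq`),
  `#ker h_0 = #E[p^∞]^{Γ_K}` for `E(K_∞)[p^∞]` finite (tree `natCard_ker_layerToInfty_eq_natCard_fixedPoints`)
  and `#Sel_0 = #Sel_{p^∞}(E/K)` give the printed shape
  `natCard_sharpFlatSelmerInvariants_mul_natCard_fixedPoints`.
* §2 (**Lemma 5.9 × Lemma 5.8**): by g4's `SharpFlatSelmerDualData.isDualPair` every datum is a dual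
  pair for `ψ = conj_γ − 1`, so the tree's Greenberg Lemma 4.2
  (`IwasawaDual.IsDualPair.constantCoeff_charGenerator_mul_natCard_endCoinvariants`:
  `f(0) · #S_Γ = u · #S^Γ`) applies verbatim; multiplied with §1:
  **`f(0) · #(Sel⋆_∞)_γ · #E[p^∞]^{Γ_K} = u · #Sel_{p^∞}(E/K) · #(A⋆_0/Sel_0)`**, `u ∈ ℤ_pˣ`
  (`SharpFlatSelmerDualData.constantCoeff_charGenerator_mul_natCard_endCoinvariants_mul_natCard_fixedPoints`,
  and `…_of_finite` deriving the finiteness of `Sel⋆_∞^γ` from that of `Sel_{p^∞}(E/K)` and `A⋆_0/Sel_0`).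
* §3 (**over `ℚ`, in the binder shape of `lem59AllN_…`**): for `W/ℚ`, `p ≠ 2` good supersingular
  (`p ∣ a_p`), the cyclotomic/Honda setting, either colour and every datum: `E(ℚ)[p] = 0` (a rational
  point of order `p` at a good `p ≥ 3` forces `a_p ≡ 1 (mod p)`, tree
  `dvd_frobeniusTrace_sub_one_of_addOrderOf_eq`; "we necessarily have `|E(ℚ)_p| = 1`", p. 41), so
  `#E[p^∞]^{Γ_ℚ} = 1` (`natCard_fixedPoints_absoluteGaloisGroup_geomPrimaryTorsion_eq_one`),
  `E(ℚ_∞)[p^∞]` is finite (`finite_fixedPoints_kerSubgroup_geomPrimaryTorsion_rat`), `h_0(Sel_0) ⊆ Sel⋆_∞`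
  (g5, from the Honda relations), whence **`f(0) · #(Sel⋆_∞)_γ = u · #Sel_{p^∞}(E/ℚ) · #(A⋆_0/Sel_0)`**
  (`constantCoeff_charGenerator_mul_natCard_sharpFlatEndCoinvariants_rat`).

WHAT REMAINS for `lem59[AllN]` is exactly Lemma 5.5 [4.5] —
`#(A⋆_0/Sel_0) · #E(ℚ)_p = p^{ord_p ∏ c_l} · #(Sel⋆_∞)_Γ` — i.e. Greenberg's Lemmas 4.4 + 4.7 with
`Sel ↦ Sel⋆` (Cassels' theorem `𝒫/𝒢 ≅ E(ℚ)_p^∨` by Poitou–Tate, the surjectivity of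
`H¹(ℚ_Σ/ℚ_∞, E[p^∞]) → 𝒫⋆(ℚ_∞)`, the Tamagawa counts `|ker r_l| = c_l^{(p)}` and "`r_p` is
injective"), which is not in the tree for the classical Selmer group either (see the closing remark
of `IwasawaEulerCharRankZeroAssemblyProofs`); it is vendored as a named fact by the sibling statement
file `Sprung2024/ChromaticCoinvariantsCard.lean` and composed with this file there-after.

HONEST FRAMING (cell `bsd-ssimc`, seat `bsd-ssimc-k3c5-kdot-split` g7, object «KDOT-L59-ASSEMBLY»;
route K3 `SignedLowerHalves`, crux 5 `SprungLowerHalfAtThree` = stmt-BirchSwinnertonDyer-19003,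
support K3 = stmt-BirchSwinnertonDyer-19878 = `lem59AllN_…` by name): kernel theorems about the tree's
transcription of Sprung's objects; nothing about any curve is asserted; no census cell moves; BSD is
not proved by any of this.

## References
* [Sprung2024] §5.2 pp. 39–41: the control diagram and `𝒢⋆`, `𝒫_E`, Lemmas 5.5, 5.8, 5.9 and
  "Proof of Theorem 5.3"; arXiv:1610.10017 §4 pp. 15–16 (Lemmas 4.4, 4.5, 4.8).
* [GreenbergLNM1716] R. Greenberg, *Iwasawa theory for elliptic curves*, LNM 1716 (1999), §4:
  Lemma 4.2 (p. 102), Lemma 4.3 (p. 103), Lemmas 4.4–4.7 (pp. 104–108); §3 Lemma 3.2 (p. 86).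
* [RaySprung2025] J. Ray, F. Sprung, Ann. Inst. Fourier 75 (2025), p. 2343 (the attribution).
* [Sprung2012] F. Sprung, J. Number Theory 132 (2012), Def. 7.9 / 7.11 (the objects).

## Design
Theorems only; `noncomputable section`; `open scoped Classical`; one universe `u`. §1 and §3 in
`namespace Literature.NumberTheory.EllipticCurves.Sprung2024`; §2 declares dot-notation extensions of
`Sprung2012.SharpFlatSelmerDualData` inside that structure's namespace (as g4/g5 did). Greenberg's
`ker g` is written out as the quotient type `↥A⋆_0 ⧸ (selmerLayer κ 0).addSubgroupOf A⋆_0` (no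
abbreviation is introduced).
-/

noncomputable section

open scoped Classical NumberField

open NumberField IsDedekindDomain

universe u

/-! ## §1 Lemma 5.8: `#Sel⋆(E/K_∞)^{Γ_K} · #ker h_0 = #Sel_0 · #(A⋆_0/Sel_0)` -/

namespace Literature.NumberTheory.EllipticCurves.Sprung2024

open Literature.NumberTheory.EllipticCurves Literature.NumberTheory.EllipticCurves.IwasawaAlgebra
  Literature.NumberTheory.EllipticCurves.IwasawaDual WeierstrassCurve ZpExtension
  Literature.NumberTheory.EllipticCurves.Sprung2017 Literature.NumberTheory.EllipticCurves.Sprung2012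

section General

variable {K : Type u} [Field K] [NumberField K] (W : WeierstrassCurve K) {p : ℕ} [Fact p.Prime]
  (κ : ZpExtension K p) {E : Type u} [Field E] [Algebra K E]
  (ι : AlgebraicClosure K →ₐ[K] AlgebraicClosure E) (ap : ℤ) (g : Field.absoluteGaloisGroup E)
  (c : ℕ → localPoints W E) (col : Chroma)

/-- **`#A⋆_0 = #Sel⋆(E/K_∞)^{Γ_K} · #ker h_0`** for `A⋆_0 = h_0⁻¹(Sel⋆(E/K_∞))`: the restriction
`h_0` maps `A⋆_0` ONTO `Sel⋆_∞ ⊓ H¹(K_∞, E[p^∞])^{Γ_K}` (into: `range_layerToInfty_le_layerInvariants`;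
onto: Greenberg's Lemma 3.2 `coker h_0 = 0` in the cocycle form
`ZpExtension.mem_range_resOfLe_of_conjH1_eq`, valid for every `ℤ_p`-extension) with kernel
`ker h_0 ⊆ A⋆_0`. An identity of `Nat.card`s, no finiteness needed. [cite: GreenbergLNM1716, §3 Lemma 3.2 (p. 86) and §4 Lemma 4.3 (p. 103)]
[cite: Sprung2024, §5.2 Lemma 5.8 (p. 41)] -/
theorem natCard_comap_layerToInfty_sharpFlatSelmerInfty :
    Nat.card ↥((sharpFlatSelmerInfty W κ ι ap g c col).comap (W.layerToInfty κ 0)) =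
      Nat.card ↥(sharpFlatSelmerInfty W κ ι ap g c col ⊓ W.layerInvariants κ 0) *
        Nat.card (W.layerToInfty κ 0).ker := by
  -- the restriction `θ : A⋆_0 → Sel⋆_∞ ⊓ H¹(K_∞)^{Γ_K}`, `y ↦ h_0 y`
  let θ : ↥((sharpFlatSelmerInfty W κ ι ap g c col).comap (W.layerToInfty κ 0)) →+
      ↥(sharpFlatSelmerInfty W κ ι ap g c col ⊓ W.layerInvariants κ 0) :=
    ((W.layerToInfty κ 0).comp
      ((sharpFlatSelmerInfty W κ ι ap g c col).comap (W.layerToInfty κ 0)).subtype).codRestrict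
      (sharpFlatSelmerInfty W κ ι ap g c col ⊓ W.layerInvariants κ 0) fun y ↦
      ⟨AddSubgroup.mem_comap.mp y.2,
        W.range_layerToInfty_le_layerInvariants_holds κ 0
          ⟨(y : W.subgroupH1 p (κ.layerSubgroup 0)), rfl⟩⟩
  have hθ : ∀ y : ↥((sharpFlatSelmerInfty W κ ι ap g c col).comap (W.layerToInfty κ 0)),
      ((θ y : ↥(sharpFlatSelmerInfty W κ ι ap g c col ⊓ W.layerInvariants κ 0)) :
          W.subgroupH1 p κ.kerSubgroup) =
        W.layerToInfty κ 0 (y : W.subgroupH1 p (κ.layerSubgroup 0)) := fun _ ↦ rfl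
  -- `θ` is onto (Greenberg's Lemma 3.2 at `n = 0`)
  have hsurj : Function.Surjective θ := by
    rintro ⟨x, hxS, hxI⟩
    obtain ⟨γ₀, hγ₀⟩ := κ.surjective (Multiplicative.ofAdd 1)
    have hγ₀' : κ.IsTopGenerator γ₀ := hγ₀
    have hfix := (W.mem_layerInvariants_iff κ 0 x).mp hxI _ (κ.pow_mem_layerSubgroup hγ₀' 0)
    have hprim : ∀ m : W.geomPrimaryTorsion p, ∃ k : ℕ, p ^ k • m = 0 := fun m ↦ by
      obtain ⟨k, hk⟩ := m.2
      exact ⟨k, Subtype.ext (by rw [AddSubgroupClass.coe_nsmul, hk, ZeroMemClass.coe_zero])⟩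
    obtain ⟨y, hy⟩ := ZpExtension.mem_range_resOfLe_of_conjH1_eq κ hγ₀' 0
      (W.continuous_smul_geomPrimaryTorsion p) hprim x hfix
    have hy' : W.layerToInfty κ 0 y = x := hy
    have hyA : y ∈ (sharpFlatSelmerInfty W κ ι ap g c col).comap (W.layerToInfty κ 0) := by
      rw [AddSubgroup.mem_comap, hy']
      exact hxS
    exact ⟨⟨y, hyA⟩, Subtype.ext ((hθ ⟨y, hyA⟩).trans hy')⟩
  -- `ker θ ≅ ker h_0` (`ker h_0 ⊆ A⋆_0`)
  have hkerle : (W.layerToInfty κ 0).ker ≤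
      (sharpFlatSelmerInfty W κ ι ap g c col).comap (W.layerToInfty κ 0) := fun y hy ↦ by
    rw [AddSubgroup.mem_comap, (AddMonoidHom.mem_ker).mp hy]
    exact zero_mem _
  have hker : θ.ker = ((W.layerToInfty κ 0).ker).addSubgroupOf
      ((sharpFlatSelmerInfty W κ ι ap g c col).comap (W.layerToInfty κ 0)) := by
    ext y
    rw [AddMonoidHom.mem_ker, AddSubgroup.mem_addSubgroupOf, AddMonoidHom.mem_ker, ← hθ]
    constructor
    · intro h
      rw [h]
      rfl
    · intro h
      exact Subtype.ext h
  rw [AddSubgroup.card_eq_card_quotient_mul_card_addSubgroup θ.ker,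
    Nat.card_congr (QuotientAddGroup.quotientKerEquivOfSurjective θ hsurj).toEquiv, hker,
    Nat.card_congr (AddSubgroup.addSubgroupOfEquivOfLe hkerle).toEquiv]

/-- **Sprung 2024, Lemma 5.8 — unconditional `Nat.card` form (Greenberg's Lemma 4.3 with
`Sel ↦ Sel⋆`): `#Sel⋆(E/K_∞)^{Γ_K} · #ker h_0 = #Sel_0 · #(A⋆_0/Sel_0)`**, for every number field,
`ℤ_p`-extension, embedding, data `(ap, g, c, ⋆)`, provided the control map exists
(`hSel : h_0(Sel_0) ⊆ Sel⋆_∞`, i.e. `Sel_0 ⊆ A⋆_0`; automatic at a supersingular `p ≠ 2` for a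
Honda system, `layerToInfty_mem_sharpFlatSelmerInfty_of_mem_selmerLayer_zero`). Printed: "**Lemma
5.8.** `|Sel⋆(E,ℚ_∞)_p^{Gal(ℚ_∞/ℚ)}| = |Sel(E,ℚ)_p| / #E(ℚ)_p × |ker g|`. *Proof.* The proof of [17,
Lemma 4.3] with '`Sel`' replaced by '`Sel⋆`' works" (before the substitution `|ker h| = |E(ℚ)_p|`).
Both sides equal `#A⋆_0` (`natCard_comap_layerToInfty_sharpFlatSelmerInfty` and
`#A⋆_0 = #(A⋆_0/Sel_0) · #Sel_0`). [cite: Sprung2024, §5.2 Lemma 5.8 (p. 41)]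
[cite: GreenbergLNM1716, §4 Lemma 4.3 (p. 103)] -/
theorem natCard_sharpFlatSelmerInvariants_mul_natCard_ker_layerToInfty
    (hSel : W.selmerLayer κ 0 ≤ (sharpFlatSelmerInfty W κ ι ap g c col).comap (W.layerToInfty κ 0)) :
    Nat.card ↥(sharpFlatSelmerInfty W κ ι ap g c col ⊓ W.layerInvariants κ 0) *
        Nat.card (W.layerToInfty κ 0).ker =
      Nat.card ↥(W.selmerLayer κ 0) *
        Nat.card (↥((sharpFlatSelmerInfty W κ ι ap g c col).comap (W.layerToInfty κ 0)) ⧸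
          (W.selmerLayer κ 0).addSubgroupOf
            ((sharpFlatSelmerInfty W κ ι ap g c col).comap (W.layerToInfty κ 0))) := by
  rw [← natCard_comap_layerToInfty_sharpFlatSelmerInfty W κ ι ap g c col,
    AddSubgroup.card_eq_card_quotient_mul_card_addSubgroup ((W.selmerLayer κ 0).addSubgroupOf
      ((sharpFlatSelmerInfty W κ ι ap g c col).comap (W.layerToInfty κ 0))),
    Nat.card_congr (AddSubgroup.addSubgroupOfEquivOfLe hSel).toEquiv, mul_comm]

/-- **`#Sel⋆(E/K_∞)^{Γ_K} = #Sel⋆(E/K_∞)^γ`** for a topological generator `γ`: the invariants of the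
control diagram at level `0` (`Sel⋆_∞ ⊓ layerInvariants 0`) and the `γ`-invariants
`endInvariants (conj_γ − 1)` of the Euler-characteristic files have the same elements (a class fixed
by `conj_γ` is fixed by `Γ_K`, `mem_layerInvariants_zero_of_conjH1_eq`) — the ♯/♭ twin of
`WeierstrassCurve.natCard_selmerInfty_inf_layerInvariants_zero_eq`.
[cite: GreenbergLNM1716, §1 p. 60 and §3 p. 86] [cite: Sprung2012, Def. 7.11 (p. 1503)] -/
theorem natCard_sharpFlatSelmerInfty_inf_layerInvariants_zero_eq {γ : Field.absoluteGaloisGroup K}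
    (hγ : κ.IsTopGenerator γ) :
    Nat.card ↥(sharpFlatSelmerInfty W κ ι ap g c col ⊓ W.layerInvariants κ 0) =
      Nat.card ↥(endInvariants (conjSharpFlatSelmerInfty W κ ι ap g c col γ - 1)) :=
  Nat.card_congr
    { toFun := fun x ↦ ⟨⟨(x : W.subgroupH1 p κ.kerSubgroup), x.2.1⟩,
        (mem_endInvariants_conjSharpFlatSelmerInfty_iff γ _).mpr
          (W.conjH1_eq_of_mem_layerInvariants_zero κ γ x.2.2)⟩
      invFun := fun s ↦ ⟨((s : sharpFlatSelmerInfty W κ ι ap g c col) : W.subgroupH1 p κ.kerSubgroup),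
        ⟨(s : sharpFlatSelmerInfty W κ ι ap g c col).2,
          W.mem_layerInvariants_zero_of_conjH1_eq κ hγ
            ((mem_endInvariants_conjSharpFlatSelmerInfty_iff γ _).mp s.2)⟩⟩
      left_inv := fun _ ↦ rfl
      right_inv := fun _ ↦ rfl }

/-- **Sprung 2024, Lemma 5.8 with `|ker h_0| = #E(K)[p^∞]` substituted (the printed shape):
`#Sel⋆(E/K_∞)^γ · #E[p^∞]^{Γ_K} = #Sel_{p^∞}(E/K) · #(A⋆_0/Sel_0)`** — printed over `ℚ` as
"`|Sel⋆(E,ℚ_∞)_p^{Gal(ℚ_∞/ℚ)}| = |Sel(E,ℚ)_p| / #E(ℚ)_p × |ker g|`" — for every number field,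
`ℤ_p`-extension with topological generator `γ`, embedding and data, provided `E(K_∞)[p^∞]` is finite
(then `#ker h_0 = #E[p^∞]^{Γ_K}`, tree `natCard_ker_layerToInfty_eq_natCard_fixedPoints`) and
`h_0(Sel_0) ⊆ Sel⋆_∞` (`hSel`). [cite: Sprung2024, §5.2 Lemma 5.8 (p. 41)]
[cite: GreenbergLNM1716, §4 Lemma 4.3 (p. 103)] -/
theorem natCard_sharpFlatSelmerInvariants_mul_natCard_fixedPoints {γ : Field.absoluteGaloisGroup K}
    (hγ : κ.IsTopGenerator γ)
    (hSel : W.selmerLayer κ 0 ≤ (sharpFlatSelmerInfty W κ ι ap g c col).comap (W.layerToInfty κ 0))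
    [Finite (FixedPoints.addSubgroup κ.kerSubgroup (W.geomPrimaryTorsion p))] :
    Nat.card ↥(endInvariants (conjSharpFlatSelmerInfty W κ ι ap g c col γ - 1)) *
        Nat.card (MulAction.fixedPoints (Field.absoluteGaloisGroup K) (W.geomPrimaryTorsion p)) =
      Nat.card ↥(W.selmerGroupPInfty p) *
        Nat.card (↥((sharpFlatSelmerInfty W κ ι ap g c col).comap (W.layerToInfty κ 0)) ⧸
          (W.selmerLayer κ 0).addSubgroupOf
            ((sharpFlatSelmerInfty W κ ι ap g c col).comap (W.layerToInfty κ 0))) := by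
  rw [← natCard_sharpFlatSelmerInfty_inf_layerInvariants_zero_eq W κ ι ap g c col hγ,
    ← W.natCard_fixedBy_layerSubgroup_zero_eq κ,
    ← W.natCard_ker_layerToInfty_eq_natCard_fixedPoints κ 0, ← W.natCard_selmerLayer_zero_eq κ]
  exact natCard_sharpFlatSelmerInvariants_mul_natCard_ker_layerToInfty W κ ι ap g c col hSel

/-- **`A⋆_0` is finite when `Sel_{p^∞}(E/K)` and `A⋆_0/Sel_0` are** (and `h_0(Sel_0) ⊆ Sel⋆_∞`):
`#A⋆_0 = #(A⋆_0/Sel_0) · #Sel_0`, `Sel_0 ≃ Sel_{p^∞}(E/K)` — the finiteness of the middle terms of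
the control diagram used in the proof of Lemma 5.8 ("where all the groups occurring are finite",
Greenberg p. 103). [cite: GreenbergLNM1716, §4 Lemma 4.3 (proof, p. 103)]
[cite: Sprung2024, §5.2 Lemma 5.8 (p. 41)] -/
theorem finite_comap_layerToInfty_sharpFlatSelmerInfty_of_finite
    (hSel : W.selmerLayer κ 0 ≤ (sharpFlatSelmerInfty W κ ι ap g c col).comap (W.layerToInfty κ 0))
    (hfin : Finite (W.selmerGroupPInfty p))
    (hg : Finite (↥((sharpFlatSelmerInfty W κ ι ap g c col).comap (W.layerToInfty κ 0)) ⧸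
      (W.selmerLayer κ 0).addSubgroupOf
        ((sharpFlatSelmerInfty W κ ι ap g c col).comap (W.layerToInfty κ 0)))) :
    Finite ↥((sharpFlatSelmerInfty W κ ι ap g c col).comap (W.layerToInfty κ 0)) := by
  haveI := hg
  haveI : Finite ↥(W.selmerLayer κ 0) := W.finite_selmerLayer_zero κ hfin
  haveI : Finite ↥((W.selmerLayer κ 0).addSubgroupOf
      ((sharpFlatSelmerInfty W κ ι ap g c col).comap (W.layerToInfty κ 0))) :=
    Finite.of_equiv _ (AddSubgroup.addSubgroupOfEquivOfLe hSel).toEquiv.symm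
  refine Nat.finite_of_card_ne_zero ?_
  rw [AddSubgroup.card_eq_card_quotient_mul_card_addSubgroup ((W.selmerLayer κ 0).addSubgroupOf
    ((sharpFlatSelmerInfty W κ ι ap g c col).comap (W.layerToInfty κ 0)))]
  exact mul_ne_zero Nat.card_pos.ne' Nat.card_pos.ne'

end General

end Literature.NumberTheory.EllipticCurves.Sprung2024

/-! ## §2 Lemma 5.9 × Lemma 5.8 for a Pontryagin-dual datum `D` of `Sel⋆(E/K_∞)` -/

namespace Literature.NumberTheory.EllipticCurves.Sprung2012

open Literature.NumberTheory.EllipticCurves Literature.NumberTheory.EllipticCurves.IwasawaAlgebra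
  Literature.NumberTheory.EllipticCurves.IwasawaDual WeierstrassCurve ZpExtension
  Literature.NumberTheory.EllipticCurves.Sprung2017 Literature.NumberTheory.EllipticCurves.Sprung2024

namespace SharpFlatSelmerDualData

variable {K : Type u} [Field K] [NumberField K] {W : WeierstrassCurve K} {p : ℕ} [Fact p.Prime]
  {κ : ZpExtension K p} {γ : Field.absoluteGaloisGroup K} {E : Type u} [Field E] [Algebra K E]
  {ι : AlgebraicClosure K →ₐ[K] AlgebraicClosure E} {ap : ℤ} {g : Field.absoluteGaloisGroup E}
  {c : ℕ → localPoints W E} {col : Chroma}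

/-- **Sprung 2024, Lemma 5.9 (= Greenberg's Lemma 4.2) for `S = Sel⋆(E/K_∞)`, `X⋆ = D.X`.** For any
`ℤ_p`-extension `K_∞/K` of a number field with topological generator `γ`, any data and any
Pontryagin-dual datum `D` with `X⋆` finitely generated torsion over `Λ` and `char(X⋆) = (f)`: if
`Sel⋆_∞^γ` is finite then `(Sel⋆_∞)_γ = Sel⋆_∞/(γ − 1)` is finite, `ord_T f = 0`, `f(0) ≠ 0`, and
**`f(0) · #(Sel⋆_∞)_γ = u · #Sel⋆_∞^γ`**, `u ∈ ℤ_pˣ` — "**Lemma 5.9.** Let `f⋆` be a generator of the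
characteristic ideal of `X⋆` and assume that `Sel⋆(E,ℚ_∞)^{Gal(ℚ_∞/ℚ)}` is finite. Then
`|f(0)|_p = |Sel⋆(E,ℚ_∞)^Γ| / |(Sel⋆(E,ℚ_∞))_Γ|`. *Proof.* This is a general fact about finitely
generated `Λ`-modules … See [17, Lemma 4.2]" — the tree's
`IsDualPair.constantCoeff_charGenerator_mul_natCard_endCoinvariants` through `D.isDualPair`.
[cite: Sprung2024, §5.2 Lemma 5.9 (p. 41)] [cite: GreenbergLNM1716, §4 Lemma 4.2 (p. 102)] -/
theorem constantCoeff_charGenerator_mul_natCard_endCoinvariants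
    (D : SharpFlatSelmerDualData W κ γ ι ap g c col) (hγ : κ.IsTopGenerator γ)
    [Module.Finite (IwasawaAlgebra p) D.X] (hX : Module.IsTorsion (IwasawaAlgebra p) D.X)
    (f : IwasawaAlgebra p) (hf : D.charIdeal = Ideal.span {f})
    (hfin : Finite ↥(endInvariants (conjSharpFlatSelmerInfty W κ ι ap g c col γ - 1))) :
    Finite (EndCoinvariants (conjSharpFlatSelmerInfty W κ ι ap g c col γ - 1)) ∧ f.order = 0 ∧
      PowerSeries.constantCoeff f ≠ 0 ∧
      ∃ u : ℤ_[p]ˣ,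
        PowerSeries.constantCoeff f *
            (Nat.card (EndCoinvariants (conjSharpFlatSelmerInfty W κ ι ap g c col γ - 1)) : ℤ_[p]) =
          u * Nat.card ↥(endInvariants (conjSharpFlatSelmerInfty W κ ι ap g c col γ - 1)) := by
  have hf' : Module.charIdeal (IwasawaAlgebra p) D.X = Ideal.span {f} := hf
  exact ⟨(D.isDualPair hγ).finite_endCoinvariants_of_finite hX hfin,
    ((D.isDualPair hγ).order_charGenerator_eq_zero_of_finite_endInvariants hX f hf' hfin).1,
    ((D.isDualPair hγ).order_charGenerator_eq_zero_of_finite_endInvariants hX f hf' hfin).2,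
    (D.isDualPair hγ).constantCoeff_charGenerator_mul_natCard_endCoinvariants hX f hf' hfin⟩

/-- **Sprung 2024, Lemmas 5.8 × 5.9 multiplied — the ♯/♭ `Γ`-Euler characteristic reduced to Lemma
5.5** (the ♯/♭ twin of
`WeierstrassCurve.SelmerDualData.constantCoeff_charGenerator_mul_natCard_coinvariants_mul_natCard_fixedPoints`,
Greenberg's Thm. 4.1 reduced to Lemmas 4.4 + 4.7). Let `E/K` be elliptic over a number field, `K_∞/K`
any `ℤ_p`-extension with topological generator `γ`, `Sel⋆(E/K_∞)` the chromatic Selmer group of the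
data `(ι, ap, g, c, ⋆)` with `h_0(Sel_0) ⊆ Sel⋆_∞` (`hSel`), `D` a Pontryagin-dual datum with `X⋆`
finitely generated torsion, `char(X⋆) = (f)`; assume `E(K_∞)[p^∞]` finite and `Sel⋆_∞^γ` finite. Then
`(Sel⋆_∞)_γ` is finite, `f(0) ≠ 0`, and
**`f(0) · #(Sel⋆_∞)_γ · #E[p^∞]^{Γ_K} = u · #Sel_{p^∞}(E/K) · #(A⋆_0/Sel_0)`**, `u ∈ ℤ_pˣ`. The
printed continuation (Lemma 5.5: `#(A⋆_0/Sel_0) · #E(K)_p = ∏ c_l^{(p)} · #(Sel⋆_∞)_Γ`) is NOT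
formalised here. [cite: Sprung2024, §5.2 Lemmas 5.8, 5.9 and Proof of Thm. 5.3 (p. 41)]
[cite: GreenbergLNM1716, §4 Thm. 4.1 (proof, pp. 102–108)] -/
theorem constantCoeff_charGenerator_mul_natCard_endCoinvariants_mul_natCard_fixedPoints
    (D : SharpFlatSelmerDualData W κ γ ι ap g c col) (hγ : κ.IsTopGenerator γ)
    [Module.Finite (IwasawaAlgebra p) D.X] (hX : Module.IsTorsion (IwasawaAlgebra p) D.X)
    (f : IwasawaAlgebra p) (hf : D.charIdeal = Ideal.span {f})
    [Finite (FixedPoints.addSubgroup κ.kerSubgroup (W.geomPrimaryTorsion p))]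
    (hSel : W.selmerLayer κ 0 ≤ (sharpFlatSelmerInfty W κ ι ap g c col).comap (W.layerToInfty κ 0))
    (hfin : Finite ↥(endInvariants (conjSharpFlatSelmerInfty W κ ι ap g c col γ - 1))) :
    Finite (EndCoinvariants (conjSharpFlatSelmerInfty W κ ι ap g c col γ - 1)) ∧
      PowerSeries.constantCoeff f ≠ 0 ∧
      ∃ u : ℤ_[p]ˣ,
        PowerSeries.constantCoeff f *
            (Nat.card (EndCoinvariants (conjSharpFlatSelmerInfty W κ ι ap g c col γ - 1)) : ℤ_[p]) *
            Nat.card (MulAction.fixedPoints (Field.absoluteGaloisGroup K) (W.geomPrimaryTorsion p)) =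
          u * Nat.card ↥(W.selmerGroupPInfty p) *
            Nat.card (↥((sharpFlatSelmerInfty W κ ι ap g c col).comap (W.layerToInfty κ 0)) ⧸
              (W.selmerLayer κ 0).addSubgroupOf
                ((sharpFlatSelmerInfty W κ ι ap g c col).comap (W.layerToInfty κ 0))) := by
  obtain ⟨hH1, -, hf0, u, hu⟩ := D.constantCoeff_charGenerator_mul_natCard_endCoinvariants hγ hX f hf hfin
  refine ⟨hH1, hf0, u, ?_⟩
  have h58 := natCard_sharpFlatSelmerInvariants_mul_natCard_fixedPoints W κ ι ap g c col hγ hSel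
  have h58' : (Nat.card ↥(endInvariants (conjSharpFlatSelmerInfty W κ ι ap g c col γ - 1)) : ℤ_[p]) *
      Nat.card (MulAction.fixedPoints (Field.absoluteGaloisGroup K) (W.geomPrimaryTorsion p)) =
        (Nat.card ↥(W.selmerGroupPInfty p) : ℤ_[p]) *
          Nat.card (↥((sharpFlatSelmerInfty W κ ι ap g c col).comap (W.layerToInfty κ 0)) ⧸
            (W.selmerLayer κ 0).addSubgroupOf
              ((sharpFlatSelmerInfty W κ ι ap g c col).comap (W.layerToInfty κ 0))) := by
    exact_mod_cast h58
  rw [hu, mul_assoc, h58', mul_assoc]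

/-- **The same from finiteness of `Sel_{p^∞}(E/K)` and of `A⋆_0/Sel_0`** (which give `A⋆_0` finite,
`finite_comap_layerToInfty_sharpFlatSelmerInfty_of_finite`, hence `Sel⋆_∞^γ` finite by Greenberg's
Lemma 3.2, `finite_endInvariants_conjSharpFlatSelmerInfty_of_finite_comap`): then `Sel⋆_∞^γ` and
`(Sel⋆_∞)_γ` are finite, `f(0) ≠ 0`, and
`f(0) · #(Sel⋆_∞)_γ · #E[p^∞]^{Γ_K} = u · #Sel_{p^∞}(E/K) · #(A⋆_0/Sel_0)`.
[cite: Sprung2024, §5.2 Lemmas 5.7, 5.8, 5.9 (p. 41)] [cite: GreenbergLNM1716, §4 Thm. 4.1 (proof, pp. 102–104)] -/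
theorem constantCoeff_charGenerator_mul_natCard_endCoinvariants_of_finite
    (D : SharpFlatSelmerDualData W κ γ ι ap g c col) (hγ : κ.IsTopGenerator γ)
    [Module.Finite (IwasawaAlgebra p) D.X] (hX : Module.IsTorsion (IwasawaAlgebra p) D.X)
    (f : IwasawaAlgebra p) (hf : D.charIdeal = Ideal.span {f})
    [Finite (FixedPoints.addSubgroup κ.kerSubgroup (W.geomPrimaryTorsion p))]
    (hSel : W.selmerLayer κ 0 ≤ (sharpFlatSelmerInfty W κ ι ap g c col).comap (W.layerToInfty κ 0))
    (hSelfin : Finite (W.selmerGroupPInfty p))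
    (hg : Finite (↥((sharpFlatSelmerInfty W κ ι ap g c col).comap (W.layerToInfty κ 0)) ⧸
      (W.selmerLayer κ 0).addSubgroupOf
        ((sharpFlatSelmerInfty W κ ι ap g c col).comap (W.layerToInfty κ 0)))) :
    Finite ↥(endInvariants (conjSharpFlatSelmerInfty W κ ι ap g c col γ - 1)) ∧
      Finite (EndCoinvariants (conjSharpFlatSelmerInfty W κ ι ap g c col γ - 1)) ∧
      PowerSeries.constantCoeff f ≠ 0 ∧
      ∃ u : ℤ_[p]ˣ,
        PowerSeries.constantCoeff f *
            (Nat.card (EndCoinvariants (conjSharpFlatSelmerInfty W κ ι ap g c col γ - 1)) : ℤ_[p]) *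
            Nat.card (MulAction.fixedPoints (Field.absoluteGaloisGroup K) (W.geomPrimaryTorsion p)) =
          u * Nat.card ↥(W.selmerGroupPInfty p) *
            Nat.card (↥((sharpFlatSelmerInfty W κ ι ap g c col).comap (W.layerToInfty κ 0)) ⧸
              (W.selmerLayer κ 0).addSubgroupOf
                ((sharpFlatSelmerInfty W κ ι ap g c col).comap (W.layerToInfty κ 0))) := by
  have hA := finite_comap_layerToInfty_sharpFlatSelmerInfty_of_finite W κ ι ap g c col hSel hSelfin hg
  have hfin : Finite ↥(endInvariants (conjSharpFlatSelmerInfty W κ ι ap g c col γ - 1)) :=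
    finite_endInvariants_conjSharpFlatSelmerInfty_of_finite_comap hγ hA
  exact ⟨hfin, D.constantCoeff_charGenerator_mul_natCard_endCoinvariants_mul_natCard_fixedPoints hγ hX
    f hf hSel hfin⟩

end SharpFlatSelmerDualData

end Literature.NumberTheory.EllipticCurves.Sprung2012

/-! ## §3 Over `ℚ` at a supersingular `p ≠ 2`, in the binder shape of `lem59AllN_…` -/

namespace Literature.NumberTheory.EllipticCurves.Sprung2024

open Literature.NumberTheory.EllipticCurves Literature.NumberTheory.EllipticCurves.IwasawaAlgebra
  Literature.NumberTheory.EllipticCurves.IwasawaDual WeierstrassCurve ZpExtension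
  Literature.NumberTheory.EllipticCurves.Sprung2017 Literature.NumberTheory.EllipticCurves.Sprung2012

/-- **`#E[p^∞]^{Γ_ℚ} = 1` at a good supersingular `p ≥ 3`** (Greenberg's / Sprung's `#E(ℚ)_p`;
"since `E[p]` is irreducible as a Galois representation, we necessarily have `|E(ℚ)_p| = 1`", p. 41):
a rational point of order `p` at a good `p ≥ 3` forces `a_p ≡ 1 (mod p)` (tree
`dvd_frobeniusTrace_sub_one_of_addOrderOf_eq`, Silverman VII.3.1), incompatible with `p ∣ a_p`; so
`E(ℚ)[p] = 0`, the binder `hK` of the tree's `natCard_fixedPoints_absoluteGaloisGroup_geomPrimaryTorsion_eq_one`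
(whose group law on `E(ℚ)` carries the classical `DecidableEq ℚ`; bridged by
`Rank1Residual.addOrderOf_point_eq_of_subsingleton`). [cite: Sprung2024, §5.2 proof of Thm. 5.3 (p. 41)]
[cite: SilvermanAEC2009, VII.3.1(b)] [cite: GreenbergLNM1716, §4 Lemma 4.3 (p. 103)] -/
theorem natCard_fixedPoints_geomPrimaryTorsion_eq_one_of_supersingular (W : WeierstrassCurve ℚ)
    [W.IsElliptic] [W.IsGloballyMinimal] (p : ℕ) [Fact p.Prime] (hp2 : p ≠ 2)
    (hgood : W.HasGoodReductionAtPrime p) (hap : (p : ℤ) ∣ W.frobeniusTrace p) :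
    Nat.card (MulAction.fixedPoints (Field.absoluteGaloisGroup ℚ) (W.geomPrimaryTorsion p)) = 1 := by
  have hp : p.Prime := Fact.out
  have hp3 : 3 ≤ p := by have := hp.two_le; omega
  refine W.natCard_fixedPoints_absoluteGaloisGroup_geomPrimaryTorsion_eq_one (p := p) fun P hP ↦ ?_
  by_contra hP0
  -- the order of `P` for the classical group-law instance carried by `hP`
  have hT := @addOrderOf_eq_prime W.toAffine.Point (@SubNegMonoid.toAddMonoid _
    (@AddGroup.toSubNegMonoid _ (@AddCommGroup.toAddGroup _
      (@WeierstrassCurve.Affine.Point.instAddCommGroup ℚ _ W.toAffine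
        fun a b ↦ Classical.propDecidable (a = b))))) P p _ hP hP0
  have h1 := dvd_frobeniusTrace_sub_one_of_addOrderOf_eq W p hp3 hgood
    ((Rank1Residual.addOrderOf_point_eq_of_subsingleton W _ _ P).trans hT)
  have hone : (p : ℤ) ∣ 1 := by simpa using dvd_sub hap h1
  have hp1 : (p : ℤ) ≤ 1 := Int.le_of_dvd one_pos hone
  omega

/-- **Sprung 2024, Lemmas 5.8 × 5.9 over `ℚ` — the ♯/♭ Euler characteristic in rank `0` reduced to
Lemma 5.5, in the binder shape of `lem59AllN_sharpFlatCharValue_rankZero`.** For `W/ℚ` elliptic and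
globally minimal, `p ≠ 2` of good supersingular reduction (`p ∣ a_p`), any `ℤ_p`-extension `κ` with
topological generator `γ` (cyclotomicity is not used), the place `v ∋ p` with the chosen embedding,
a local lift `g` of a generator, a Honda system `(cneg, c)`, either colour `⋆`, any Pontryagin-dual
datum `D` of `Sel⋆(E/ℚ_∞)` with `X⋆ = D.X` finitely generated torsion and `char(X⋆) = (f)`: IF
`Sel_{p^∞}(E/ℚ)` and `ker g = A⋆_0/Sel_0` are finite, THEN `Sel⋆_∞^γ`, `(Sel⋆_∞)_γ` are finite,
`f(0) ≠ 0` and **`f(0) · #(Sel⋆_∞)_γ = u · #Sel_{p^∞}(E/ℚ) · #(A⋆_0/Sel_0)`** for a unit `u ∈ ℤ_pˣ`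
— Lemmas 5.8 and 5.9 multiplied with `#E(ℚ)_p = 1` (`natCard_fixedPoints_geomPrimaryTorsion_eq_one_of_supersingular`),
`E(ℚ_∞)[p^∞]` finite (`finite_fixedPoints_kerSubgroup_geomPrimaryTorsion_rat`) and the control map
`Sel(E/ℚ) → Sel⋆(E/ℚ_∞)` (g5: `Ker Col⋆ ⊥ E(ℚ_p)` from the Honda relations,
`layerToInfty_mem_sharpFlatSelmerInfty_of_mem_selmerLayer_zero`). With Lemma 5.5
(`#(A⋆_0/Sel_0) = p^{ord_p ∏ c_l} · #(Sel⋆_∞)_γ`, vendored separately) this is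
`f(0) = u' · p^{ord_p ∏ c_l} · #Sel_{p^∞}(E/ℚ)`, the body of `lem59AllN_…`.
[cite: Sprung2024, §5.2 Lemmas 5.8, 5.9 and Proof of Thm. 5.3 (p. 41)]
[cite: GreenbergLNM1716, §4 Thm. 4.1, Lemmas 4.2–4.3 (pp. 102–103)] [cite: RaySprung2025, p. 2343] -/
theorem constantCoeff_charGenerator_mul_natCard_sharpFlatEndCoinvariants_rat
    (W : WeierstrassCurve ℚ) [W.IsElliptic] [W.IsGloballyMinimal] (p : ℕ) [Fact p.Prime]
    (hp2 : p ≠ 2) (hgood : W.HasGoodReductionAtPrime p) (hap : (p : ℤ) ∣ W.frobeniusTrace p)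
    (κ : ZpExtension ℚ p) {γ : Field.absoluteGaloisGroup ℚ} (hγ : κ.IsTopGenerator γ)
    (v : HeightOneSpectrum (𝓞 ℚ)) {g : Field.absoluteGaloisGroup (v.adicCompletion ℚ)}
    (hg : κ.IsTopGenerator (resGalOfEmb (closureEmb (K := ℚ) (v.adicCompletion ℚ)) g))
    {cneg : localPoints W (v.adicCompletion ℚ)} {c : ℕ → localPoints W (v.adicCompletion ℚ)}
    (hH : IsHondaSystem κ (closureEmb (K := ℚ) (v.adicCompletion ℚ)) W (W.frobeniusTrace p) g cneg c)
    (col : Chroma)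
    (D : SharpFlatSelmerDualData W κ γ (closureEmb (K := ℚ) (v.adicCompletion ℚ))
      (W.frobeniusTrace p) g c col)
    [Module.Finite (IwasawaAlgebra p) D.X] (hX : Module.IsTorsion (IwasawaAlgebra p) D.X)
    (f : IwasawaAlgebra p) (hf : D.charIdeal = Ideal.span {f})
    (hfin : Finite (W.selmerGroupPInfty p))
    (hkerg : Finite (↥((sharpFlatSelmerInfty W κ (closureEmb (K := ℚ) (v.adicCompletion ℚ))
        (W.frobeniusTrace p) g c col).comap (W.layerToInfty κ 0)) ⧸
      (W.selmerLayer κ 0).addSubgroupOf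
        ((sharpFlatSelmerInfty W κ (closureEmb (K := ℚ) (v.adicCompletion ℚ))
          (W.frobeniusTrace p) g c col).comap (W.layerToInfty κ 0)))) :
    Finite ↥(endInvariants (conjSharpFlatSelmerInfty W κ (closureEmb (K := ℚ) (v.adicCompletion ℚ))
        (W.frobeniusTrace p) g c col γ - 1)) ∧
      Finite (EndCoinvariants (conjSharpFlatSelmerInfty W κ (closureEmb (K := ℚ) (v.adicCompletion ℚ))
        (W.frobeniusTrace p) g c col γ - 1)) ∧
      PowerSeries.constantCoeff f ≠ 0 ∧
      ∃ u : ℤ_[p]ˣ,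
        PowerSeries.constantCoeff f *
            (Nat.card (EndCoinvariants (conjSharpFlatSelmerInfty W κ
              (closureEmb (K := ℚ) (v.adicCompletion ℚ)) (W.frobeniusTrace p) g c col γ - 1)) : ℤ_[p]) =
          u * Nat.card ↥(W.selmerGroupPInfty p) *
            Nat.card (↥((sharpFlatSelmerInfty W κ (closureEmb (K := ℚ) (v.adicCompletion ℚ))
                (W.frobeniusTrace p) g c col).comap (W.layerToInfty κ 0)) ⧸
              (W.selmerLayer κ 0).addSubgroupOf
                ((sharpFlatSelmerInfty W κ (closureEmb (K := ℚ) (v.adicCompletion ℚ))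
                  (W.frobeniusTrace p) g c col).comap (W.layerToInfty κ 0))) := by
  -- `E(ℚ_∞)[p^∞]` is finite
  haveI := W.finite_fixedPoints_kerSubgroup_geomPrimaryTorsion_rat κ (p := p)
  -- the control map `Sel_0 → Sel⋆_∞` exists (`Ker Col⋆ ⊥ E(ℚ_p)`)
  have hSel : W.selmerLayer κ 0 ≤ (sharpFlatSelmerInfty W κ (closureEmb (K := ℚ) (v.adicCompletion ℚ))
      (W.frobeniusTrace p) g c col).comap (W.layerToInfty κ 0) := fun y hy ↦
    AddSubgroup.mem_comap.mpr (layerToInfty_mem_sharpFlatSelmerInfty_of_mem_selmerLayer_zero W κ v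
      (fun z hz x hx ↦ colemanKer_apply_eq_zero_of_mem_localLayerPointsOfEmb_zero κ _ W hp2 hap hg hH
        col hz hx) hy)
  obtain ⟨h0, h1, hf0, u, hu⟩ :=
    D.constantCoeff_charGenerator_mul_natCard_endCoinvariants_of_finite hγ hX f hf hSel hfin hkerg
  refine ⟨h0, h1, hf0, u, ?_⟩
  rw [natCard_fixedPoints_geomPrimaryTorsion_eq_one_of_supersingular W p hp2 hgood hap, Nat.cast_one,
    mul_one] at hu
  exact hu

end Literature.NumberTheory.EllipticCurves.Sprung2024

end
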